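import Mathlib
import HarnessLib
import Summits.ValiantsHypothesis.ValiantsHypothesis.Theses.MonotoneRestoration
import Summits.ValiantsHypothesis.ValiantsHypothesis.Theorems.MonotoneRestorationOrbitRestorationQPValueOrbitDivision
import Summits.ValiantsHypothesis.ValiantsHypothesis.Theorems.MonotoneRestorationQP.Negative.OrbitRestorationFalseOfPolylogWidthVP

/-!
# Route MonotoneRestoration, crux `OrbitRestorationQP` (stmt-ValiantsHypothesis-18293) — THE GLUED KILL FORMAT
# (counting width at a `Sym_n`-fixed base point; helper, def-free)

The landed kill pipeline `not_qpOrbitSymmetric_of_polylogSeparating` (refuter file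
`Theorems/MonotoneRestorationQP/Negative/OrbitRestorationFalseOfPolylogWidthVP.lean`) refutes quasi-polynomial ORBIT
restorability of a complex family `f` from a separation of `≡^{C^k}`-equivalent SIMPLE GRAPHS by the values of `f n` at
their `0/1` adjacency matrices.  A matrix-symmetric `f` reads a `0/1` adjacency matrix as a TWO-SORTED structure (rows
and columns are not identified), so at `0/1` points it is blind to the bipartite double cover (`2K₃` versus `C₆`,
certified in `…OrbitRestorationQPDoubleCoverBlindness.lean`, p826135).

This file records that the blindness is an artefact of the base point `0`.  Orbit complexity is invariant under
translation by any point `a` FIXED by the diagonal action of `Sym(Fin n)` (`a = α·I + β·(J − I)`), by the landed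
`ValueOrbitDivision.qpOrbitRestorable_translate` (value-orbit currency, symmetric substitution).  Hence the kill
pipeline applies verbatim to the translated family `x ↦ f n (a + x)`, i.e. to the values of `f n` at the GLUED points
`a + 1_X` — and through the marked diagonal `α·I` the two-sorted structure `a + 1_X` remembers the one-sorted graph `X`
(odd cycles become visible: `hom_{C₄}` at `I + 1_{2K₃}` and `I + 1_{C₆}` takes the values `162 ≠ 114`).

* `eval_translate` — `(f(x + a))(v) = f(v + a)` (bookkeeping);
* `not_qpOrbit_of_gluedSeparating` — **the engine at a fixed base point**: if for every level `c` and beyond every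
  order `N` there are `m ≥ N` and `X ≡^{C^{(log₂ m + c)^c}} Y` on `Fin m` with `f m (a m + 1_X) ≠ f m (a m + 1_Y)`, where
  every `a m` is fixed by the diagonal action, then `f` has NO square-symmetric circuits of quasi-polynomial orbit size;
* `orbitRestorationQP_false_of_gluedSeparating` — **¬ L1** (crux 18293) from ONE matrix-symmetric `VP` family that is
  glued-separating at some invariant base points; `monotoneRestorationQP_false_of_gluedSeparating` (crux 15886) and
  `nonnegRestorationQP_false_of_gluedSeparating` (target 16191) by the landed glue;
* `gluedSeparating_of_separating` / `gluedSeparating_of_polylogWidthVP` — the old format is the case `a = 0`, so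
  `PolylogWidthVP` implies the glued hypothesis: the new witness class is at least as large, and it admits ONE-SORTED
  graph invariants `X ↦ f m (α I + β (J − I) + 1_X)` (`orbitRestorationQP_false_of_diagonalGluedSeparating`,
  `diagonalPoint_invariant`).

Honest label: glue over landed theorems (translation invariance + Boolean kill pipeline); a refuter's format, no
witness supplied; no stub closed; VP ≠ VNP untouched. [folklore; cite: DawarWilsenach2025 §6–§7; Strassen1973]
-/

-- `Summit.ValiantsHypothesis.ValiantsHypothesis.…` is the tree's mandated namespace (Sub = Summit).
set_option linter.dupNamespace false

noncomputable section

namespace Summit.ValiantsHypothesis.ValiantsHypothesis.Theorems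

namespace GluedKill

open MvPolynomial
open Summit.ValiantsHypothesis.ValiantsHypothesis.Theses.MonotoneRestoration
open Literature.Computability.AlgebraicComplexity
open Literature.ModelTheory.FiniteModelTheory
open OrbitRestorationQPDepthThreeRung

/-- Evaluating the translate `p(x + a)` at `v` is evaluating `p` at `v + a`. [folklore] -/
theorem eval_translate {n : ℕ} (a v : Fin n × Fin n → ℂ) (p : MvPolynomial (Fin n × Fin n) ℂ) :
    eval v (aeval (fun x : Fin n × Fin n => X x + C (a x)) p) = eval (fun x => v x + a x) p := by
  induction p using MvPolynomial.induction_on with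
  | C c => simp only [algHom_C, algebraMap_eq, eval_C]
  | add p q hp hq => simp only [map_add, hp, hq]
  | mul_X p i hp => simp only [map_mul, hp, aeval_X, map_add, eval_X, eval_C]

/-- **THE ENGINE AT A FIXED BASE POINT.**  Let `a n : Fin n × Fin n → ℂ` be fixed by the diagonal action of
`Sym(Fin n)` for every `n`.  If the values of `f m` at the glued points `a m + 1_X` separate, for every level `c` and
beyond every order `N`, two `≡^{C^{(log₂ m + c)^c}}`-equivalent simple graphs `X, Y` on `Fin m`, then `f` has no
square-symmetric circuits of quasi-polynomial ORBIT size.  Proof: a quasi-polynomial-orbit circuit for `f n` is one for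
the translate `f n (x + a n)` at level `c + 3` (`ValueOrbitDivision.qpOrbitRestorable_translate`), and the translated
family is polylog-separating at `0/1` points, contradicting `not_qpOrbitSymmetric_of_polylogSeparating`.
[cite: DawarWilsenach2025, Thm 5.1, §6, §7.1; Strassen1973] -/
theorem not_qpOrbit_of_gluedSeparating (f : (n : ℕ) → MvPolynomial (Fin n × Fin n) ℂ)
    (a : (n : ℕ) → Fin n × Fin n → ℂ)
    (ha : ∀ (n : ℕ) (σ : Equiv.Perm (Fin n)) (x : Fin n × Fin n), a n (σ • x) = a n x)
    (hsep : ∀ c N : ℕ, ∃ m : ℕ, N ≤ m ∧ ∃ X Y : SimpleGraph (Fin m),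
        CkEquiv ((Nat.log 2 m + c) ^ c) X Y ∧
          eval (fun ij : Fin m × Fin m => Set.indicator {ij : Fin m × Fin m | X.Adj ij.1 ij.2} 1 ij + a m ij) (f m) ≠
            eval (fun ij : Fin m × Fin m => Set.indicator {ij : Fin m × Fin m | Y.Adj ij.1 ij.2} 1 ij + a m ij) (f m)) :
    ¬ ∃ c : ℕ, ∀ n : ℕ, ∃ (G : Type) (_ : Fintype G)
      (C : LabelledArithCircuit ℂ (Fin n × Fin n) Unit G),
      C.IsSymmetric (Equiv.Perm (Fin n)) ∧ C.eval (C.output ()) = f n ∧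
        C.orbitSize (Equiv.Perm (Fin n)) ≤ 2 ^ ((Nat.log 2 n + c) ^ c) := by
  rintro ⟨c, hc⟩
  -- the translated family
  set g : (n : ℕ) → MvPolynomial (Fin n × Fin n) ℂ :=
    fun n => aeval (fun x : Fin n × Fin n => X x + C (a n x)) (f n) with hg
  -- it is restorable at level `c + 3`
  have hgc : ∀ n : ℕ, QPOrbitRestorable (c + 3) n (g n) := fun n =>
    ValueOrbitDivision.qpOrbitRestorable_translate (a n) (ha n) (hc n)
  -- and polylog-separating at `0/1` points
  refine not_qpOrbitSymmetric_of_polylogSeparating g ?_ ⟨c + 3, hgc⟩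
  intro c' N
  obtain ⟨m, hNm, X, Y, hXY, hne⟩ := hsep c' N
  refine ⟨m, hNm, X, Y, hXY, ?_⟩
  simpa only [hg, eval_translate] using hne

/-- **¬ L1 FROM A GLUED-SEPARATING FAMILY** (crux `OrbitRestorationQP`, stmt-ValiantsHypothesis-18293, quoted by name):
one matrix-symmetric `VP` family over `ℂ` whose values at glued points `a m + 1_X` (all `a m` fixed by the diagonal
action) separate `≡^{C^{(log₂ m + c)^c}}`-equivalent simple graphs for every `c` beyond every order refutes the crux.
[cite: DawarWilsenach2025, §7.1] -/
theorem orbitRestorationQP_false_of_gluedSeparating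
    (h : ∃ f : (n : ℕ) → MvPolynomial (Fin n × Fin n) ℂ,
      (∀ (n : ℕ) (σ τ : Equiv.Perm (Fin n)),
        MvPolynomial.rename (fun p : Fin n × Fin n => (σ p.1, τ p.2)) (f n) = f n) ∧
      IsVPFamily f ∧
      ∃ a : (n : ℕ) → Fin n × Fin n → ℂ,
        (∀ (n : ℕ) (σ : Equiv.Perm (Fin n)) (x : Fin n × Fin n), a n (σ • x) = a n x) ∧
        ∀ c N : ℕ, ∃ m : ℕ, N ≤ m ∧ ∃ X Y : SimpleGraph (Fin m),
          CkEquiv ((Nat.log 2 m + c) ^ c) X Y ∧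
            eval (fun ij : Fin m × Fin m => Set.indicator {ij : Fin m × Fin m | X.Adj ij.1 ij.2} 1 ij + a m ij) (f m) ≠
              eval (fun ij : Fin m × Fin m => Set.indicator {ij : Fin m × Fin m | Y.Adj ij.1 ij.2} 1 ij + a m ij)
                (f m)) :
    ¬ OrbitRestorationQP := by
  rintro hL1
  obtain ⟨f, hsymm, hVP, a, ha, hsep⟩ := h
  exact not_qpOrbit_of_gluedSeparating f a ha hsep (hL1 f hsymm hVP)

/-- The same for the crux `MonotoneRestorationQP` (stmt-ValiantsHypothesis-15886), through the landed
`monotoneRestorationQP_implies_orbitRestoration` (THEOREM ε and `orbitSize ≤ size`). [folklore] -/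
theorem monotoneRestorationQP_false_of_gluedSeparating
    (h : ∃ f : (n : ℕ) → MvPolynomial (Fin n × Fin n) ℂ,
      (∀ (n : ℕ) (σ τ : Equiv.Perm (Fin n)),
        MvPolynomial.rename (fun p : Fin n × Fin n => (σ p.1, τ p.2)) (f n) = f n) ∧
      IsVPFamily f ∧
      ∃ a : (n : ℕ) → Fin n × Fin n → ℂ,
        (∀ (n : ℕ) (σ : Equiv.Perm (Fin n)) (x : Fin n × Fin n), a n (σ • x) = a n x) ∧
        ∀ c N : ℕ, ∃ m : ℕ, N ≤ m ∧ ∃ X Y : SimpleGraph (Fin m),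
          CkEquiv ((Nat.log 2 m + c) ^ c) X Y ∧
            eval (fun ij : Fin m × Fin m => Set.indicator {ij : Fin m × Fin m | X.Adj ij.1 ij.2} 1 ij + a m ij) (f m) ≠
              eval (fun ij : Fin m × Fin m => Set.indicator {ij : Fin m × Fin m | Y.Adj ij.1 ij.2} 1 ij + a m ij)
                (f m)) :
    ¬ MonotoneRestorationQP := by
  rintro hM
  obtain ⟨f, hsymm, hVP, a, ha, hsep⟩ := h
  exact not_qpOrbit_of_gluedSeparating f a ha hsep (monotoneRestorationQP_implies_orbitRestoration hM f hsymm hVP)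

/-- The same for the target `NonnegRestorationQP` (stmt-ValiantsHypothesis-16191), through `stub_target_implies_crux`.
[folklore] -/
theorem nonnegRestorationQP_false_of_gluedSeparating
    (h : ∃ f : (n : ℕ) → MvPolynomial (Fin n × Fin n) ℂ,
      (∀ (n : ℕ) (σ τ : Equiv.Perm (Fin n)),
        MvPolynomial.rename (fun p : Fin n × Fin n => (σ p.1, τ p.2)) (f n) = f n) ∧
      IsVPFamily f ∧
      ∃ a : (n : ℕ) → Fin n × Fin n → ℂ,
        (∀ (n : ℕ) (σ : Equiv.Perm (Fin n)) (x : Fin n × Fin n), a n (σ • x) = a n x) ∧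
        ∀ c N : ℕ, ∃ m : ℕ, N ≤ m ∧ ∃ X Y : SimpleGraph (Fin m),
          CkEquiv ((Nat.log 2 m + c) ^ c) X Y ∧
            eval (fun ij : Fin m × Fin m => Set.indicator {ij : Fin m × Fin m | X.Adj ij.1 ij.2} 1 ij + a m ij) (f m) ≠
              eval (fun ij : Fin m × Fin m => Set.indicator {ij : Fin m × Fin m | Y.Adj ij.1 ij.2} 1 ij + a m ij)
                (f m)) :
    ¬ NonnegRestorationQP := fun hX =>
  monotoneRestorationQP_false_of_gluedSeparating h (stub_target_implies_crux hX)

/-- **The old format is the case `a = 0`.**  A family separating at `0/1` points is glued-separating at the (fixed)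
base point `0`. [folklore] -/
theorem gluedSeparating_of_separating (f : (n : ℕ) → MvPolynomial (Fin n × Fin n) ℂ)
    (hsep : ∀ c N : ℕ, ∃ m : ℕ, N ≤ m ∧ ∃ X Y : SimpleGraph (Fin m),
        CkEquiv ((Nat.log 2 m + c) ^ c) X Y ∧
          eval (Set.indicator {ij : Fin m × Fin m | X.Adj ij.1 ij.2} 1) (f m) ≠
            eval (Set.indicator {ij : Fin m × Fin m | Y.Adj ij.1 ij.2} 1) (f m)) :
    ∃ a : (n : ℕ) → Fin n × Fin n → ℂ,
      (∀ (n : ℕ) (σ : Equiv.Perm (Fin n)) (x : Fin n × Fin n), a n (σ • x) = a n x) ∧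
      ∀ c N : ℕ, ∃ m : ℕ, N ≤ m ∧ ∃ X Y : SimpleGraph (Fin m),
        CkEquiv ((Nat.log 2 m + c) ^ c) X Y ∧
          eval (fun ij : Fin m × Fin m => Set.indicator {ij : Fin m × Fin m | X.Adj ij.1 ij.2} 1 ij + a m ij) (f m) ≠
            eval (fun ij : Fin m × Fin m => Set.indicator {ij : Fin m × Fin m | Y.Adj ij.1 ij.2} 1 ij + a m ij) (f m) := by
  refine ⟨fun _ _ => 0, fun _ _ _ => rfl, fun c N => ?_⟩
  obtain ⟨m, hNm, X, Y, hXY, hne⟩ := hsep c N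
  refine ⟨m, hNm, X, Y, hXY, ?_⟩
  simpa only [add_zero] using hne

/-- Hence the landed kill hypothesis `PolylogWidthVP` implies the glued kill hypothesis (the witness class of the new
format contains the old one; `¬ L1` from `PolylogWidthVP` itself is the landed `orbitRestorationQP_false_of_polylogWidthVP`).
[folklore] -/
theorem gluedSeparating_of_polylogWidthVP (hH : PolylogWidthVP) :
    ∃ f : (n : ℕ) → MvPolynomial (Fin n × Fin n) ℂ,
      (∀ (n : ℕ) (σ τ : Equiv.Perm (Fin n)),
        MvPolynomial.rename (fun p : Fin n × Fin n => (σ p.1, τ p.2)) (f n) = f n) ∧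
      IsVPFamily f ∧
      ∃ a : (n : ℕ) → Fin n × Fin n → ℂ,
        (∀ (n : ℕ) (σ : Equiv.Perm (Fin n)) (x : Fin n × Fin n), a n (σ • x) = a n x) ∧
        ∀ c N : ℕ, ∃ m : ℕ, N ≤ m ∧ ∃ X Y : SimpleGraph (Fin m),
          CkEquiv ((Nat.log 2 m + c) ^ c) X Y ∧
            eval (fun ij : Fin m × Fin m => Set.indicator {ij : Fin m × Fin m | X.Adj ij.1 ij.2} 1 ij + a m ij) (f m) ≠
              eval (fun ij : Fin m × Fin m => Set.indicator {ij : Fin m × Fin m | Y.Adj ij.1 ij.2} 1 ij + a m ij)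
                (f m) := by
  obtain ⟨f, hsymm, hVP, hsep⟩ := hH
  exact ⟨f, hsymm, hVP, gluedSeparating_of_separating f hsep⟩

/-- **The diagonal base points are fixed.**  `a = α·I + β·(J − I)` (value `α` on the diagonal, `β` off it) is fixed by
the diagonal action of `Sym(Fin n)` — the base points at which the glued format is used. [folklore] -/
theorem diagonalPoint_invariant {n : ℕ} (α β : ℂ) (σ : Equiv.Perm (Fin n)) (x : Fin n × Fin n) :
    (fun ij : Fin n × Fin n => if ij.1 = ij.2 then α else β) (σ • x) =
      (fun ij : Fin n × Fin n => if ij.1 = ij.2 then α else β) x := by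
  simp only [Prod.smul_fst, Prod.smul_snd, Equiv.Perm.smul_def, EmbeddingLike.apply_eq_iff_eq]

/-- **¬ L1 FROM A FAMILY SEPARATING AT DIAGONAL BASE POINTS** `α_m·I + β_m·(J − I) + 1_X` — the user-facing form
of the glued format (the base points are fixed by `diagonalPoint_invariant`). [cite: DawarWilsenach2025, §7.1] -/
theorem orbitRestorationQP_false_of_diagonalGluedSeparating
    (h : ∃ f : (n : ℕ) → MvPolynomial (Fin n × Fin n) ℂ,
      (∀ (n : ℕ) (σ τ : Equiv.Perm (Fin n)),
        MvPolynomial.rename (fun p : Fin n × Fin n => (σ p.1, τ p.2)) (f n) = f n) ∧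
      IsVPFamily f ∧
      ∃ α β : ℕ → ℂ,
        ∀ c N : ℕ, ∃ m : ℕ, N ≤ m ∧ ∃ X Y : SimpleGraph (Fin m),
          CkEquiv ((Nat.log 2 m + c) ^ c) X Y ∧
            eval (fun ij : Fin m × Fin m => Set.indicator {ij : Fin m × Fin m | X.Adj ij.1 ij.2} 1 ij +
                (if ij.1 = ij.2 then α m else β m)) (f m) ≠
              eval (fun ij : Fin m × Fin m => Set.indicator {ij : Fin m × Fin m | Y.Adj ij.1 ij.2} 1 ij +
                (if ij.1 = ij.2 then α m else β m)) (f m)) :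
    ¬ OrbitRestorationQP := by
  obtain ⟨f, hsymm, hVP, α, β, hsep⟩ := h
  exact orbitRestorationQP_false_of_gluedSeparating ⟨f, hsymm, hVP,
    fun n ij => if ij.1 = ij.2 then α n else β n, fun n σ x => diagonalPoint_invariant (α n) (β n) σ x, hsep⟩

end GluedKill

end Summit.ValiantsHypothesis.ValiantsHypothesis.Theorems

end
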